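import Mathlib
import Summits.KontsevichZagierPeriods.Zeta5Search.BrickDigitStrip

/-!
# BrickDigitStripMain — the DIGIT-STRIPPING FACTORISATION assembled:
`F_j(pT) = λ_j·F̃_J(T)·U_j(T)`, `U_j ∈ 1 + pTℤ_(p)⟦T⟧`, `λ_j·c̃_{J,A}(N) = c_{j,A}(n)` (zi-p2 THEOREM 6 (E2),
PLAN-T7 (★), THEOREM 7 LEMMA 2 with `E_j = 1`; cell zeta5-irr)

HONEST FRAMING: systematic search; no irrationality claim unless certified. INSTRUMENT lemma of the ζ(5)
census cell zeta5-irr (HOME `run/shared/lean/pub/zeta5-irr/`; memo `zi-p2/probes/B8/thm6/THEOREM6.md` Step E⁺ (E2),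
`zi-p2/probes/B8/thm7-plan/PLAN-T7.md` L7.2 (★)). Nothing here is about ζ(5); no irrationality content; filing
moves no rung. Filed by the engine seat zi-eng (g8); sequel of `BrickDigitStrip` (the three offset families).

## The statement

`p` an odd prime, `n = n₀ + N·p`, `j = j₀ + J·p`, MAIN CASE `j₀ ≤ n₀ < p`, `n₀ + j₀ < p`, `n₀ + (n₀ − j₀) < p`, `J ≤ N`,
and `ε = 0` or `p ∤ n − 2j`. Then (`num_comp_eq`, `den_comp_eq`) the numerator and the pole-free denominator of
`F_j(pT)` are `C(const)·(those of F̃_J(T))·(unit polynomial)`, and (`laurentSeries_rescale_eq`):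

**`rescale_p(laurentSeries A B ε n j) = C(λ)·laurentSeries A B 0 N J·U`**, `U(0) = 1`,
`ScaledSeries.IsSlopeInt p (−1) 0 U` (`[T^g]U ∈ p^gℤ_(p)`), **`λ·laurent A B 0 N J 0 = laurent A B ε n j 0`**
(`λ = c_{j,A}(n)/c̃_{J,A}(N)` — the top coefficient `c̃_{J,A}(N) ≠ 0`). Coefficientwise (`laurent_rescale_eq_sum`):
`p^d·laurent A B ε n j d = λ·Σ_{e+g=d} laurent A B 0 N J e·[T^g]U`, the exact two-scale identity behind (E1⁺) and
THEOREM 7's recursive residue law `r_j ≡ λ_j r̃_{j′} (mod p²)`.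
-/

namespace Summit.KontsevichZagierPeriods.Zeta5Search.BrickDigitStripMain

open Finset Nat Polynomial WithZero
open Summit.KontsevichZagierPeriods.Zeta5Search.BrickLaurent (expandAt laurentSeries laurent kerNum kerDenErase
  constantCoeff_coe_taylor coe_comp_C_mul_X rescale_inv eval_kerDenErase_neg_ne_zero)
open Summit.KontsevichZagierPeriods.Zeta5Search.BrickLaurentValuation (taylor_kerNum taylor_kerDenErase)
open Summit.KontsevichZagierPeriods.Zeta5Search.ScaledSeries (IsSlopeInt isSlopeInt_mul)
open Summit.KontsevichZagierPeriods.Zeta5Search.BrickPhiCoeff (isSlopeInt_inv)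
open Summit.KontsevichZagierPeriods.Zeta5Search.BrickDigitStrip (IsUnitPoly den_family num_family_one num_family_two
  centre_factor)

noncomputable section

variable {p : ℕ} [Fact p.Prime]

section main

variable (hp2 : p ≠ 2) {A B ε N n₀ J j₀ : ℕ} (hn₀ : n₀ < p) (hj₀ : j₀ ≤ n₀) (h1 : n₀ + j₀ < p)
  (h2 : n₀ + (n₀ - j₀) < p) (hJN : J ≤ N)
include hn₀ hj₀

/-- DENOMINATOR: `taylor_{−j}(kerDenErase_j)(pX) = C(b)·taylor_{−J}(kerDenErase_J at level N)·V`, `V` unit, `b ≠ 0`. -/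
theorem den_comp_eq (A N J : ℕ) : ∃ V : ℚ[X], IsUnitPoly p V ∧ ∃ b : ℚ, b ≠ 0 ∧
    (taylor (-((j₀ + J * p : ℕ) : ℚ)) (kerDenErase A (n₀ + N * p) (j₀ + J * p))).comp (C (p : ℚ) * X) =
      C b * taylor (-(J : ℚ)) (kerDenErase A N J) * V := by
  obtain ⟨V, hV, c, hc, hVeq⟩ := den_family (p := p) hn₀ hj₀ N J
  refine ⟨V ^ A, hV.pow A, c ^ A, pow_ne_zero _ hc, ?_⟩
  rw [taylor_kerDenErase, taylor_kerDenErase, pow_comp, Polynomial.prod_comp]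
  simp only [add_comp, X_comp, C_comp]
  rw [hVeq, mul_pow, mul_pow, map_pow]

include hp2 h1 h2 hJN

/-- NUMERATOR: `taylor_{−j}(kerNum^{ε}_n)(pX) = C(a)·taylor_{−J}(kerNum^{0}_N)·V`, `V` unit, `a ≠ 0`
(`ε = 0` or `p ∤ n − 2j`). -/
theorem num_comp_eq (hcen : ε = 0 ∨ ¬ (p : ℤ) ∣ ((n₀ + N * p : ℕ) : ℤ) - 2 * (j₀ + J * p : ℕ)) :
    ∃ V : ℚ[X], IsUnitPoly p V ∧ ∃ a : ℚ, a ≠ 0 ∧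
      (taylor (-((j₀ + J * p : ℕ) : ℚ)) (kerNum A B ε (n₀ + N * p))).comp (C (p : ℚ) * X) =
        C a * taylor (-(J : ℚ)) (kerNum A B 0 N) * V := by
  obtain ⟨Vc, hVc, cc, hcc, hceq⟩ := centre_factor (p := p) hp2 (ε := ε) (n := n₀ + N * p) (j := j₀ + J * p)
    (by rcases hcen with h | h; exacts [Or.inl h, Or.inr (by push_cast at h ⊢; exact h)])
  obtain ⟨V₁, hV₁, c₁, hc₁, h₁⟩ := num_family_one (p := p) hn₀ hj₀ h1 N J
  obtain ⟨V₂, hV₂, c₂, hc₂, h₂⟩ := num_family_two (p := p) hn₀ hj₀ h2 hJN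
  set P₁ : ℚ[X] := ∏ t ∈ Icc 1 N, (X + C (-((J : ℚ) + t))) with hP₁
  set P₂ : ℚ[X] := ∏ t ∈ Icc 1 N, (X + C ((N : ℚ) + t - J)) with hP₂
  have hNf : ((N ! : ℚ)) ^ (A - 2 * B) ≠ 0 := pow_ne_zero _ (by positivity)
  have hnf : (((n₀ + N * p)! : ℚ)) ^ (A - 2 * B) ≠ 0 := pow_ne_zero _ (by positivity)
  set a : ℚ := (((n₀ + N * p)! : ℚ)) ^ (A - 2 * B) * cc * c₁ ^ B * c₂ ^ B / ((N ! : ℚ)) ^ (A - 2 * B) with ha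
  have key : C ((((n₀ + N * p)! : ℚ)) ^ (A - 2 * B)) * C cc * C c₁ ^ B * C c₂ ^ B = C a * C (((N ! : ℚ)) ^ (A - 2 * B)) := by
    rw [← map_pow, ← map_pow, ← map_mul, ← map_mul, ← map_mul, ← map_mul, ha, div_mul_cancel₀ _ hNf]
  refine ⟨Vc * (V₁ ^ B * V₂ ^ B), hVc.mul ((hV₁.pow B).mul (hV₂.pow B)), a,
    div_ne_zero (mul_ne_zero (mul_ne_zero (mul_ne_zero hnf hcc) (pow_ne_zero _ hc₁)) (pow_ne_zero _ hc₂)) hNf, ?_⟩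
  rw [taylor_kerNum, taylor_kerNum]
  simp only [mul_comp, pow_comp, Polynomial.prod_comp, add_comp, X_comp, C_comp]
  rw [hceq, h₁, h₂, pow_zero, mul_one]
  linear_combination (Vc * V₁ ^ B * V₂ ^ B * P₁ ^ B * P₂ ^ B) * key

/-- **THE DIGIT-STRIPPING FACTORISATION** (E2)/(★): for `n = n₀ + Np`, `j = j₀ + Jp` in the main case,
`rescale_p(F_j) = C(λ)·F̃_J·U` with `U(0) = 1`, `[T^g]U ∈ p^gℤ_(p)`, and `λ·c̃_{J,A}(N) = c_{j,A}(n)`. -/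
theorem laurentSeries_rescale_eq {n j : ℕ} (hn : n = n₀ + N * p) (hj : j = j₀ + J * p)
    (hcen : ε = 0 ∨ ¬ (p : ℤ) ∣ (n : ℤ) - 2 * j) :
    ∃ U : PowerSeries ℚ, PowerSeries.constantCoeff U = 1 ∧ IsSlopeInt p (-1) 0 U ∧ ∃ lam : ℚ,
      PowerSeries.rescale (p : ℚ) (laurentSeries A B ε n j) = PowerSeries.C lam * laurentSeries A B 0 N J * U ∧
      lam * laurent A B 0 N J 0 = laurent A B ε n j 0 := by
  subst hn hj
  obtain ⟨V₁, hV₁, a, ha, hN⟩ := num_comp_eq (p := p) hp2 hn₀ hj₀ h1 h2 hJN (A := A) (B := B)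
    (by rcases hcen with h | h; exacts [Or.inl h, Or.inr (by push_cast at h ⊢; exact h)])
  obtain ⟨V₂, hV₂, b, hb, hD⟩ := den_comp_eq (p := p) hn₀ hj₀ A N J
  have hV₁0 : PowerSeries.constantCoeff (V₁ : PowerSeries ℚ) = 1 := by
    rw [Polynomial.constantCoeff_coe, coeff_zero_eq_eval_zero, hV₁.1]
  have hV₂0 : PowerSeries.constantCoeff (V₂ : PowerSeries ℚ) = 1 := by
    rw [Polynomial.constantCoeff_coe, coeff_zero_eq_eval_zero, hV₂.1]
  have hU0 : PowerSeries.constantCoeff ((V₁ : PowerSeries ℚ) * (V₂ : PowerSeries ℚ)⁻¹) = 1 := by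
    rw [map_mul, PowerSeries.constantCoeff_inv, hV₁0, hV₂0, inv_one, mul_one]
  have hUint : IsSlopeInt p (-1) 0 ((V₁ : PowerSeries ℚ) * (V₂ : PowerSeries ℚ)⁻¹) := by
    have h := isSlopeInt_mul hV₁.2 (isSlopeInt_inv hV₂.2 (by rw [hV₂0, map_one]))
    rwa [add_zero] at h
  -- the identity
  have hid : PowerSeries.rescale (p : ℚ) (laurentSeries A B ε (n₀ + N * p) (j₀ + J * p)) =
      PowerSeries.C (a / b) * laurentSeries A B 0 N J * ((V₁ : PowerSeries ℚ) * (V₂ : PowerSeries ℚ)⁻¹) := by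
    have hL : PowerSeries.rescale (p : ℚ) (laurentSeries A B ε (n₀ + N * p) (j₀ + J * p)) =
        (((taylor (-((j₀ + J * p : ℕ) : ℚ)) (kerNum A B ε (n₀ + N * p))).comp (C (p : ℚ) * X) : ℚ[X]) :
          PowerSeries ℚ) *
        ((((taylor (-((j₀ + J * p : ℕ) : ℚ)) (kerDenErase A (n₀ + N * p) (j₀ + J * p))).comp (C (p : ℚ) * X) :
          ℚ[X]) : PowerSeries ℚ))⁻¹ := by
      rw [laurentSeries, expandAt, map_mul, rescale_inv _ (by
        rw [constantCoeff_coe_taylor]; exact eval_kerDenErase_neg_ne_zero _ _ _), coe_comp_C_mul_X, coe_comp_C_mul_X]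
    rw [hL, hN, hD, laurentSeries, expandAt]
    simp only [Polynomial.coe_mul, Polynomial.coe_C, PowerSeries.mul_inv_rev, PowerSeries.C_inv]
    rw [div_eq_mul_inv, map_mul]
    ring
  refine ⟨_, hU0, hUint, a / b, hid, ?_⟩
  -- constant terms
  have h0 := congrArg (PowerSeries.coeff 0) hid
  rw [PowerSeries.coeff_rescale, pow_zero, one_mul, mul_assoc, PowerSeries.coeff_C_mul,
    PowerSeries.coeff_zero_eq_constantCoeff_apply (laurentSeries A B 0 N J * _), map_mul, hU0, mul_one,
    ← PowerSeries.coeff_zero_eq_constantCoeff_apply] at h0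
  exact h0.symm

/-- **Coefficientwise**: `p^d·laurent A B ε n j d = λ·Σ_{(e,g), e+g=d} laurent A B 0 N J e·[T^g]U`. -/
theorem laurent_rescale_eq_sum {n j : ℕ} (hn : n = n₀ + N * p) (hj : j = j₀ + J * p)
    (hcen : ε = 0 ∨ ¬ (p : ℤ) ∣ (n : ℤ) - 2 * j) :
    ∃ U : PowerSeries ℚ, PowerSeries.constantCoeff U = 1 ∧ IsSlopeInt p (-1) 0 U ∧ ∃ lam : ℚ,
      (∀ d : ℕ, (p : ℚ) ^ d * laurent A B ε n j d =
        lam * ∑ x ∈ antidiagonal d, laurent A B 0 N J x.1 * PowerSeries.coeff x.2 U) ∧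
      lam * laurent A B 0 N J 0 = laurent A B ε n j 0 := by
  obtain ⟨U, hU0, hUint, lam, hid, hlam⟩ := laurentSeries_rescale_eq (p := p) hp2 hn₀ hj₀ h1 h2 hJN (A := A) (B := B)
    hn hj hcen
  refine ⟨U, hU0, hUint, lam, fun d => ?_, hlam⟩
  have h := congrArg (PowerSeries.coeff d) hid
  rw [PowerSeries.coeff_rescale, mul_assoc, PowerSeries.coeff_C_mul, PowerSeries.coeff_mul] at h
  exact h

end main

end

end Summit.KontsevichZagierPeriods.Zeta5Search.BrickDigitStripMain
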